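import Literature.NumberTheory.Kottwitz1992.KottwitzTriples
import Literature.NumberTheory.Automorphic.LocalOrbitalIntegral
import HarnessLib

/-!
# Kottwitz 1992, §16 «Counting fixed points of `Φ_𝔭^j ∘ f` within a single isogeny class» (pp. 429–434)

Topic `Literature/NumberTheory/Kottwitz1992` (carpet of R. E. Kottwitz, *Points on some Shimura varieties over finite
fields*, J. Amer. Math. Soc. 5 (1992) 373–444 [Kottwitz1992]; held copy `paper:doi-10-2307-2152772`, file `p00NN` =
printed page `372 + NN`; §16 = pdf 57–62 = pp. 429–434). STATEMENTS (named facts, D-0014) and two generic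
DEFINITIONS with bodies (no tactic blocks); no theorem, no `sorry`, no `axiom`, no `instance`, no `notation`. Namespace
`Literature.NumberTheory.Kottwitz1992.FixedPointCount` (squad TK file map, 2026-09-02). §16 has no numbered items; the
load-bearing displayed statements are typed (squad ruling), each docstring quoting the print.

## The printed statements (pp. 429–434)

Setting (p. 429): notation of §5 (`S_{K^p}` the moduli scheme, base-changed to `k̄`), `Φ_𝔭` its Frobenius, `j ≥ 1`,
`g ∈ G(𝔸_f^p)`, `f` the Hecke correspondence `S ←a– S' –b→ S` (`S' = S_{K^p_g}`, `K^p_g = K^p ∩ g K^p g⁻¹`, §6), and the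
correspondence `Φ_𝔭^j ∘ f = (a, c)`, `c = Φ_𝔭^j ∘ b`. «By a fixed point we mean an element of `S'(k̄)` whose images in
`S(k̄)` under `a` and `c` coincide.» To a fixed point `(A, λ, i, η̄)` is associated the `c`-polarized virtual
`B`-abelian variety `(𝐀, λ, i)`, `𝐀 = (A, u)`, `c = p^r c₀`, `r = j[k(𝔭) : 𝔽_p]` (pp. 429–430).

* (p. 430–431) «Our next goal is to show that `(𝐀, λ, i)` satisfies the three conditions of §14.» — shown there.
* (p. 432) «there is a bijection from the set of fixed points `(A, λ, i, η̄)` with `(𝐀, λ, i)` isogenous to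
  `(𝐀₀, λ₀, i₀)` to the quotient set `I(ℚ)\(Y^p × Y_p)`, where
  `Y^p = {y ∈ G(𝔸_f^p)/K^p_g | y⁻¹γy ∈ K^p g⁻¹}`, `Y_p = {x ∈ G(L_r)/K_r | x⁻¹δσ(x) ∈ K_r σ(a) K_r}`.»
* (p. 432) «the cardinality of this set is … equal to `vol(I(ℚ)\I(𝔸_f)) · O_γ(f̃^p) · TO_δ(φ̃_r)`», `f̃^p` the
  characteristic function of `K^p g⁻¹`, `φ̃_r` that of `K_r σ(a) K_r`, Haar measures giving `K^p_g`, `K_r` measure 1,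
  `O_γ(f̃^p) = ∫_{I(𝔸_f^p)\G(𝔸_f^p)} f̃^p(y⁻¹γy)`, `TO_δ(φ̃_r) = ∫_{I(ℚ_p)\G(L_r)} φ̃_r(x⁻¹δσ(x))` (`I(𝔸_f^p) = G_γ(𝔸_f^p)`
  by Lemma 10.7, `I(ℚ_p) = G_{δσ}(ℚ_p)` by Lemma 10.8).
* (p. 432) «It is easy to check that `O_γ(f̃^p) = O_γ(f^p)`, where `f^p` is the characteristic function of
  `K^p g⁻¹ K^p` and the orbital integral `O_γ(f^p)` is taken with respect to the Haar measure on `G(𝔸_f^p)` giving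
  `K^p` measure 1».
* (p. 433) «The conclusion is that the number of fixed points `(A, λ, i, η̄)` for which `(𝐀, λ, i)` is isogenous to
  `(𝐀₀, λ₀, i₀)` is equal to `vol(I(ℚ)\I(𝔸_f)) · O_γ(f^p) · TO_δ(φ_r)`, where `f^p` is the characteristic function of
  `K^p g⁻¹ K^p`, `φ_r` is the characteristic function of `K_r a K_r`, and where the Haar measure on `G(𝔸_f^p)`
  (respectively, `G(L_r)`) … is the one giving measure 1 to `K^p` (respectively, `K_r`).»
* (p. 434) «the trace of the automorphism `β` induced by our correspondence at a fixed point `x'` is equal to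
  `tr ρ(γ)`, where `γ ∈ G(𝔸_f^p)` is the element associated to the `c`-polarized virtual `B`-abelian variety `𝐀`
  obtained from `x'` … the trace `tr ρ(γ)` is also equal to `tr ξ(γ₀)`.»

## What is vendored, and in which vocabulary

GENERIC DEFINITIONS (with bodies), in the currency of the tree's orbital integrals
(`Literature.NumberTheory.Automorphic.orbitalIntegral γ f m = ∫_{G ⧸ C(γ)} f(y γ y⁻¹) dm(y)`, left cosets):
* `twistedCentralizer σ δ` — the `σ`-centralizer `{c | c δ σ(c)⁻¹ = δ}` (print: `G_{δσ}`, «the twisted centralizer of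
  `δ`», p. 432), for a group endomorphism `σ`, as the equaliser of `c ↦ δ⁻¹cδ` and `σ` (`MonoidHom.eqLocus`);
* `twistedOrbitalIntegral σ δ f m = ∫_{G ⧸ C_σ(δ)} f(y δ σ(y)⁻¹) dm(y)` — `TO_δ(f)` (the print's
  `∫_{G_{δσ}\G} φ(x⁻¹δσ(x)) dx` after `y = x⁻¹`, the convention of `orbitalIntegral`), the measure a PARAMETER, the
  integrand written through `Quotient.out` (proof-free; representative-independent, see its docstring).
GENERIC NAMED FACTS (closed, Mathlib level; the «easy to check» step of p. 432):
* `Kottwitz1992_16_heckeCosetCount` — for a subgroup `K`, `g`, `z`: the cosets `kK_g ∈ K/K_g` (`K_g = K ∩ gKg⁻¹`) with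
  `z k ∈ K g⁻¹` number exactly one if `z ∈ K g⁻¹ K` and zero otherwise (the pointwise identity
  `𝟙_{Kg⁻¹K}(z) = Σ_{kK_g} 𝟙_{Kg⁻¹}(k⁻¹ z k)` behind `O_γ(f̃^p) = O_γ(f^p)`);
* `Kottwitz1992_16_orbitalIntegral_hecke` — for a compact open subgroup `K` of a topological group and an invariant
  measure `m` on `G ⧸ C(γ)`: `O_γ^m(𝟙_{K g⁻¹ K}) = [K : K_g] · O_γ^m(𝟙_{K g⁻¹})` (= the print's `O_γ(f̃^p) = O_γ(f^p)`
  once the two Haar normalisations `K^p_g ↦ 1`, `K^p ↦ 1` are written on ONE measure).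
THE POSITED DATUM `FixedPointData D IQ Λ` (ONE structure OVER the landed §14 datum `D : KottwitzTripleData` of the
squad file ★ `Literature.NumberTheory.Kottwitz1992.KottwitzTriples`, imported — no §14 notion is re-posited: `D.Obj`,
`D.GAfp`, `D.GLr`, `D.GQ`, `D.Iso1/gammaOf/Iso2/deltaOf`, `D.MaxTorus/Emb/IsStarHom/gamma0Of`, `D.Assumptions` are used
by name; `Fix`, `tr`, `trXi` named as in ★ `TotalFixedPoints`): the group structures on the bare carriers `G(𝔸_f^p)`,
`G(L_r)` and the group `I(ℚ)` are instance PARAMETERS (no instance is declared), the fixed choices of §16 for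
`(𝐀₀, λ₀, i₀)` (`iso1`, `iso2`, hence `gamma`, `delta`), `sigma`, `K^p`, `g`, `K_r`, `a`, the embeddings
`I(ℚ) → G(𝔸_f^p)`, `I(ℚ) → G(L_r)`, the two orbital measures and `vol(I(ℚ)\I(𝔸_f))`, and the traces; two glue
predicates `ConjAfpCompatible`, `SigmaConjCompatible` say that the posited conjugacy relations of `D` are the ones of
the group law (pp. 418–419). Over it: `Kpg`, `gamma`, `delta`, `Yp`,
`YL`, `orbits` (= `I(ℚ)\(Y^p × Y_p)` as the set of `I(ℚ)`-orbits of points of `Y^p × Y_p`), `FixIsog`, and the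
statements `Kottwitz1992_16_fixedPoint_assumptions`, `…_fixedPoints_bijection`, `…_card_fixedPoints_tilde`,
`…_card_fixedPoints`, `…_trace_fixedPoint`, all `def … (F : FixedPointData D IQ Λ) : Prop` PREDICATES on the datum.

VACUITY / JUNK audit: no defaulted field, no `Prop`-valued field; `Nat.card` appears only together with `Finite` in the
same conclusion; the orbital integrals are Bochner integrals (junk `0` when not integrable — the facts assert the
printed equality for the book's measures, documented on the fields); `orbits` is formed in the ambient
`G(𝔸_f^p)/K^p_g × G(L_r)/K_r` (in the book's instance `I(ℚ)` preserves `Y^p × Y_p` by Lemmas 10.7–10.8).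

## What is NOT here

The moduli problem of §5 and the correspondence as schemes (squad file `ModuliProblem`); virtual abelian varieties
(§10, `VirtualAbelianVarieties`); the construction of `(γ₀; γ, δ)` (§14 — imported from ★ `KottwitzTriples`, not restated); the relative-position
statement `K_r x⁻¹δσ(x) K_r = K_r σ(a) K_r` and the lattice description of `K_H i(a) K_H` by the determinant
condition (p. 431); the first displayed integral over `I(ℚ)\(G(𝔸_f^p) × G(L_r))` (p. 432); the twisted steps
`TO_δ(φ̃_r) = TO_{σ⁻¹(δ)}(φ_r) = TO_δ(φ_r)` (pp. 432–433: change of variables `x ↦ σ(x)` and `σ`-conjugation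
invariance — they need transport of quotient measures, cf. `InvariantQuotientOrbitalTransport`); all proofs.

## References

* R. E. Kottwitz, *Points on some Shimura varieties over finite fields*, J. Amer. Math. Soc. 5 (1992) 373–444: §16
  pp. 429–434; §6 p. 392 (`K^p_g`, Hecke correspondences); §10 pp. 402–406 (Lemmas 10.7, 10.8); §14 pp. 418–422.
  [Kottwitz1992]
* J. D. Rogawski, *Automorphic Representations of Unitary Groups in Three Variables* (1990), §4.9 p. 54 (orbital
  integrals; the tree's `orbitalIntegral`). [Rogawski1990]
-/

noncomputable section

open MeasureTheory
open scoped Pointwise ENNReal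

namespace Literature.NumberTheory.Kottwitz1992.FixedPointCount

open Literature.NumberTheory.Automorphic (orbitalIntegral)
open Literature.NumberTheory.Kottwitz1992.KottwitzTriples (KottwitzTripleData)

universe u

/-! ## §1 Twisted centralizers and twisted orbital integrals (generic definitions) -/

section Twisted

variable {G : Type*} [Group G] (σ : G →* G) (δ : G)

/-- **The twisted (`σ`-)centralizer** `G_{δσ} = {c ∈ G | c δ σ(c)⁻¹ = δ}` of `δ` for a group endomorphism `σ`
(print: «`G_{δσ}(ℚ_p)`, the twisted centralizer of `δ` in `G(L_r)`»), realised proof-free as the equaliser of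
`Int(δ)⁻¹ = (c ↦ δ⁻¹ c δ)` and `σ`: `δ⁻¹ c δ = σ(c) ↔ c δ σ(c)⁻¹ = δ` (`MonoidHom.eqLocus`, `MulAut.conj_inv_apply`).
[cite: Kottwitz1992, §16 (p. 432)] -/
def twistedCentralizer : Subgroup G :=
  MonoidHom.eqLocus ((MulAut.conj δ)⁻¹).toMonoidHom σ

/-- **The twisted orbital integral** `TO_δ^m(f) = ∫_{G ⧸ C_σ(δ)} f(y δ σ(y)⁻¹) dm(y)` of `f : G → E` at `δ` against a
measure `m` on the coset space of the twisted centralizer `C_σ(δ) = twistedCentralizer σ δ` (for a given σ-algebra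
on it); print: `TO_δ(φ) = ∫_{G_{δσ}(ℚ_p)\G(L_r)} φ(x⁻¹δσ(x)) dx` (right cosets; `y = x⁻¹` here, the convention of the
tree's `orbitalIntegral`). The integrand is written through the representative `Quotient.out y` to keep this
statements-only file proof-free; its value `f(y δ σ(y)⁻¹)` does not depend on the representative since
`(y c) δ σ(y c)⁻¹ = y (c δ σ(c)⁻¹) σ(y)⁻¹ = y δ σ(y)⁻¹` for `c ∈ C_σ(δ)`. The measure is a parameter: no normalisation
is chosen. [cite: Kottwitz1992, §16 (p. 432)]
-- TODO(definitions file): the descended integrand via `Quotient.liftOn'` with its `_mk` lemma, as `descConj`. -/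
def twistedOrbitalIntegral {E : Type*} [NormedAddCommGroup E] [NormedSpace ℝ E]
    [MeasurableSpace (G ⧸ twistedCentralizer σ δ)] (f : G → E) (m : Measure (G ⧸ twistedCentralizer σ δ)) : E :=
  ∫ y : G ⧸ twistedCentralizer σ δ, f (Quotient.out y * δ * (σ (Quotient.out y))⁻¹) ∂m

end Twisted

/-! ## §2 The «easy to check» step `O_γ(f̃^p) = O_γ(f^p)` (generic, closed named facts) -/

/-- **`𝟙_{K g⁻¹ K}(z) = Σ_{kK_g ∈ K/K_g} 𝟙_{K g⁻¹}(k⁻¹ z k)`, `K_g = K ∩ g K g⁻¹`**, in counting form: for a subgroup `K`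
of a group `G` and `g, z ∈ G`, the condition `z k ∈ K g⁻¹` on `k ∈ K` depends only on the coset `k K_g`, exactly one
such coset exists when `z ∈ K g⁻¹ K`, and none otherwise. (The pointwise identity behind «It is easy to check that
`O_γ(f̃^p) = O_γ(f^p)`», `f̃^p = 𝟙_{K^p g⁻¹}`, `f^p = 𝟙_{K^p g⁻¹ K^p}`.) [cite: Kottwitz1992, §16 (p. 432)] -/
def Kottwitz1992_16_heckeCosetCount : Prop :=
  ∀ (G : Type u) [Group G] (K : Subgroup G) (g z : G),
    (∀ k c : G, k ∈ K → c ∈ K ⊓ K.map (MulAut.conj g).toMonoidHom →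
        (z * k ∈ (K : Set G) * {g⁻¹} ↔ z * (k * c) ∈ (K : Set G) * {g⁻¹})) ∧
    (z ∈ (K : Set G) * {g⁻¹} * (K : Set G) →
        ∃ k ∈ K, z * k ∈ (K : Set G) * {g⁻¹} ∧
          ∀ k' ∈ K, z * k' ∈ (K : Set G) * {g⁻¹} → k⁻¹ * k' ∈ K ⊓ K.map (MulAut.conj g).toMonoidHom) ∧
    (z ∉ (K : Set G) * {g⁻¹} * (K : Set G) → ∀ k ∈ K, z * k ∉ (K : Set G) * {g⁻¹})

/-- **`O_γ(f̃^p) = O_γ(f^p)` on one measure**: for a topological group `G`, a compact open subgroup `K`, `g ∈ G`,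
`K_g = K ∩ g K g⁻¹` (of finite index in `K`), and a `G`-invariant measure `m` on `G ⧸ C(γ)`:
`O_γ^m(𝟙_{K g⁻¹ K}) = [K : K_g] · O_γ^m(𝟙_{K g⁻¹})`. With the print's normalisations (Haar measure giving `K^p_g`
measure 1 for `f̃^p = 𝟙_{K^p g⁻¹}`, giving `K^p` measure 1 for `f^p = 𝟙_{K^p g⁻¹ K^p}`; the former is `[K^p : K^p_g]`
times the latter) this is «It is easy to check that `O_γ(f̃^p) = O_γ(f^p)`». [cite: Kottwitz1992, §16 (p. 432)] -/
def Kottwitz1992_16_orbitalIntegral_hecke : Prop :=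
  ∀ (G : Type u) [Group G] [TopologicalSpace G] [IsTopologicalGroup G] (γ : G)
    [MeasurableSpace (G ⧸ Subgroup.centralizer ({γ} : Set G))]
    [BorelSpace (G ⧸ Subgroup.centralizer ({γ} : Set G))]
    (m : Measure (G ⧸ Subgroup.centralizer ({γ} : Set G)))
    [SMulInvariantMeasure G (G ⧸ Subgroup.centralizer ({γ} : Set G)) m]
    (K : Subgroup G) (g : G), IsOpen (K : Set G) → IsCompact (K : Set G) →
      orbitalIntegral γ (((K : Set G) * {g⁻¹} * (K : Set G)).indicator (1 : G → ℝ)) m =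
        ((K ⊓ K.map (MulAut.conj g).toMonoidHom).relIndex K : ℝ) *
          orbitalIntegral γ (((K : Set G) * {g⁻¹}).indicator (1 : G → ℝ)) m

/-! ## §3 The posited datum of §16 -/

/-- **The data of Kottwitz's §16 AS A DATUM.** Fixed behind it (not fields): the PEL datum of §5 (Cases A, C), the
moduli scheme `S_{K^p}` over `k̄`, `Φ_𝔭`, `j`, `r = j[k(𝔭) : 𝔽_p]`, `c = p^r c₀` (p. 429). PARAMETERS: the §14 datum
`D : KottwitzTripleData` of ★ `KottwitzTriples` (objects `D.Obj` = `c`-polarized virtual `B`-abelian varieties over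
`k_r` up to isogeny, carriers `D.GAfp = G(𝔸_f^p)`, `D.GLr = G(L_r)`, `D.GQ = G(ℚ)`, the choices `Iso1`, `Iso2`,
`MaxTorus`, `Emb` with `gammaOf`, `deltaOf`, `gamma0Of`, and `D.Assumptions`), group structures on the bare carriers
`D.GAfp`, `D.GLr` (instance parameters; no instance is declared here), `IQ = I(ℚ)` for `I = Aut(𝐀₀, λ₀, i₀)`
(p. 431), and `Λ` the coefficients of the traces (the `λ`-adic field of §6). Fields: the fixed `(𝐀₀, λ₀, i₀)`
(`base`) and «isogenous» (`IsQIsog`, p. 431); the fixed points (`Fix`, p. 429) with `objOf` (p. 430); the FIXED isomorphisms of §16 for the base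
(`iso1`, `iso2`, p. 432: «As in §14 we fix isomorphisms … and use them to get `γ ∈ G(𝔸_f^p)` and `δ ∈ G(L_r)`»);
`σ` on `G(L_r)`; `I(ℚ) → I(𝔸_f^p) = G_γ(𝔸_f^p) ⊂ G(𝔸_f^p)` (`iotaP`, Lemma 10.7) and `I(ℚ) → I(ℚ_p) = G_{δσ}(ℚ_p) ⊂ G(L_r)`
(`iotaL`, Lemma 10.8); `K^p`, `g`, `K_r`, `a = μ(p⁻¹)` (p. 430); the orbital measure `mGamma` on `G(𝔸_f^p) ⧸ C(γ)` and the
twisted orbital measure `mDelta` on `G(L_r) ⧸ C_σ(δ)` of the print's normalisation «`K^p ↦ 1`, `K_r ↦ 1`» (p. 433), the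
volume `vol(I(ℚ)\I(𝔸_f))` (p. 432); the traces `tr` (of `β` on the stalk at a fixed point, p. 433), `trRho`
(`g ↦ tr ρ(g)`), `trXi` (`γ₀ ↦ tr ξ(γ₀)`, p. 434). No field asserts a printed statement (squad ruling V1).
[cite: Kottwitz1992, §16 (pp. 429–434)] -/
structure FixedPointData (D : KottwitzTripleData.{u}) (IQ Λ : Type u) [Group D.GAfp] [Group D.GLr] [Group IQ]
    [∀ γ : D.GAfp, MeasurableSpace (D.GAfp ⧸ Subgroup.centralizer ({γ} : Set D.GAfp))]
    [∀ H : Subgroup D.GLr, MeasurableSpace (D.GLr ⧸ H)] : Type (u + 1) where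
  /-- the fixed `(𝐀₀, λ₀, i₀)`, satisfying the three conditions of §14 [§16 p. 431] -/
  base : D.Obj
  /-- «isogenous»: there exists a ℚ-isogeny `φ : 𝐀 → 𝐀'` compatible with the `B`-actions and polarizations (up to
  `ℚ^×`) [§16 p. 431] -/
  IsQIsog : D.Obj → D.Obj → Prop
  /-- the fixed points of the correspondence `Φ_𝔭^j ∘ f`: «an element of `S'(k̄)` whose images in `S(k̄)` under `a`
  and `c` coincide» [§16 p. 429] -/
  Fix : Type u
  /-- the `c`-polarized virtual `B`-abelian variety `(𝐀, λ, i)`, `𝐀 = (A, u)`, associated to a fixed point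
  `(A, λ, i, η̄)` [§16 pp. 429–430] -/
  objOf : Fix → D.Obj
  /-- the isomorphism `H₁(𝐀₀, 𝔸_f^p) ≅ V ⊗ 𝔸_f^p` FIXED in §16 [§16 p. 432] -/
  iso1 : D.Iso1 base
  /-- the isomorphism `H ≅ V ⊗ L_r` FIXED in §16 [§16 p. 432] -/
  iso2 : D.Iso2 base
  /-- `σ` acting on `G(L_r)` (from the Frobenius of `L_r`) [§10 p. 403; §16 p. 432] -/
  sigma : D.GLr →* D.GLr
  /-- `I(ℚ) → I(𝔸_f^p) = G_γ(𝔸_f^p) ⊂ G(𝔸_f^p)` (Lemma 10.7) [§16 p. 432] -/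
  iotaP : IQ →* D.GAfp
  /-- `I(ℚ) → I(ℚ_p) = G_{δσ}(ℚ_p) ⊂ G(L_r)` (Lemma 10.8) [§16 p. 432] -/
  iotaL : IQ →* D.GLr
  /-- the compact open subgroup `K^p ⊂ G(𝔸_f^p)` [§5 p. 390; §16 p. 429] -/
  Kp : Subgroup D.GAfp
  /-- `g ∈ G(𝔸_f^p)` defining the Hecke correspondence `f` [§6 p. 392; §16 p. 429] -/
  g : D.GAfp
  /-- `K_r ⊂ G(L_r)`, the stabiliser of the lattice `Λ₀` (hyperspecial) [§16 p. 430] -/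
  Kr : Subgroup D.GLr
  /-- `a = μ(p⁻¹) ∈ S(L_r)`, `K_r a K_r` the canonical double coset [§16 p. 430] -/
  a : D.GLr
  /-- the measure on `G(𝔸_f^p) ⧸ C(γ)`, `γ = gammaOf base iso1`, induced by the Haar measure on `G(𝔸_f^p)` giving
  `K^p` measure 1 and the Haar measure on `I(𝔸_f^p)` entering `vol` [§16 pp. 432–433] -/
  mGamma : Measure (D.GAfp ⧸ Subgroup.centralizer ({D.gammaOf base iso1} : Set D.GAfp))
  /-- the measure on `G(L_r) ⧸ C_σ(δ)`, `δ = deltaOf base iso2`, induced by the Haar measure on `G(L_r)` giving `K_r`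
  measure 1 and the Haar measure on `I(ℚ_p)` entering `vol` [§16 pp. 432–433] -/
  mDelta : Measure (D.GLr ⧸ twistedCentralizer sigma (D.deltaOf base iso2))
  /-- `vol(I(ℚ)\I(𝔸_f))` (counting measure on `I(ℚ)`, the Haar measure on `I(𝔸_f) = I(𝔸_f^p) × I(ℚ_p)` of `mGamma`, `mDelta`)
  [§16 p. 432] -/
  vol : ℝ
  /-- the trace of the automorphism `β` of the stalk `𝓕_x` at the fixed point `x'` over `x` [§16 p. 433] -/
  tr : Fix → Λ
  /-- `g ↦ tr ρ(g)`, `ρ` the representation of `G(𝔸_f^p)` on `W` defining the sheaves `𝓕_{K^p}` [§6 p. 392; §16 p. 433] -/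
  trRho : D.GAfp → Λ
  /-- `γ₀ ↦ tr ξ(γ₀)`, `ξ` the representation of `G` on a finite-dimensional `L`-vector space [§6 p. 392; §16 p. 434] -/
  trXi : D.GQ → Λ

/-- **Compatibility of the posited conjugacy of ★ `KottwitzTriples` with the group law on `G(𝔸_f^p)`**: «`γ, γ'`
are conjugate» (`D.IsConjAfp`) is conjugacy `IsConj` for the group structure supplied on the carrier `D.GAfp`, AS A
RELATION (glue between the bare-carrier datum of §14 and the orbital integrals of §16). [cite: Kottwitz1992, §14 (p. 418)] -/
def ConjAfpCompatible (D : KottwitzTripleData.{u}) [Group D.GAfp] : Prop :=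
  ∀ γ γ' : D.GAfp, D.IsConjAfp γ γ' ↔ IsConj γ γ'

/-- **Compatibility of the posited `σ`-conjugacy of ★ `KottwitzTriples` with the group law on `G(L_r)` and `σ`**:
«replaces `δ` by a `σ`-conjugate `xδσ(x)⁻¹` (`x ∈ G(L_r)`)» — `D.IsSigmaConj δ δ' ↔ ∃ x, δ' = x δ σ(x)⁻¹`, AS A
RELATION. [cite: Kottwitz1992, §14 (p. 419)] -/
def SigmaConjCompatible (D : KottwitzTripleData.{u}) [Group D.GLr] (σ : D.GLr →* D.GLr) : Prop :=
  ∀ δ δ' : D.GLr, D.IsSigmaConj δ δ' ↔ ∃ x : D.GLr, δ' = x * δ * (σ x)⁻¹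

namespace FixedPointData

variable {D : KottwitzTripleData.{u}} {IQ Λ : Type u} [Group D.GAfp] [Group D.GLr] [Group IQ]
  [∀ γ : D.GAfp, MeasurableSpace (D.GAfp ⧸ Subgroup.centralizer ({γ} : Set D.GAfp))]
  [∀ H : Subgroup D.GLr, MeasurableSpace (D.GLr ⧸ H)]
  (F : FixedPointData D IQ Λ)

/-- `γ ∈ G(𝔸_f^p)` attached to `(𝐀₀, λ₀, i₀)` by the fixed isomorphism [cite: Kottwitz1992, §16 (p. 432)] -/
def gamma : D.GAfp := D.gammaOf F.base F.iso1

/-- `δ ∈ G(L_r)` attached to `(𝐀₀, λ₀, i₀)` by the fixed isomorphism [cite: Kottwitz1992, §16 (p. 432)] -/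
def delta : D.GLr := D.deltaOf F.base F.iso2

/-- `K^p_g = K^p ∩ g K^p g⁻¹` [cite: Kottwitz1992, §6 (p. 392); §16 (p. 429)] -/
def Kpg : Subgroup D.GAfp := F.Kp ⊓ F.Kp.map (MulAut.conj F.g).toMonoidHom

/-- `Y^p = {y ∈ G(𝔸_f^p)/K^p_g | y⁻¹ γ y ∈ K^p g⁻¹}` (as the image in `G(𝔸_f^p)/K^p_g` of `{y | y⁻¹γy ∈ K^p g⁻¹}`;
the condition is `K^p_g`-invariant). [cite: Kottwitz1992, §16 (p. 432)] -/
def Yp : Set (D.GAfp ⧸ F.Kpg) :=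
  {q | ∃ y : D.GAfp, (y : D.GAfp ⧸ F.Kpg) = q ∧ y⁻¹ * F.gamma * y ∈ (F.Kp : Set D.GAfp) * {F.g⁻¹}}

/-- `Y_p = {x ∈ G(L_r)/K_r | x⁻¹ δ σ(x) ∈ K_r σ(a) K_r}` (as the image in `G(L_r)/K_r` of
`{x | x⁻¹δσ(x) ∈ K_r σ(a) K_r}`). [cite: Kottwitz1992, §16 (p. 432)] -/
def YL : Set (D.GLr ⧸ F.Kr) :=
  {q | ∃ x : D.GLr, (x : D.GLr ⧸ F.Kr) = q ∧ x⁻¹ * F.delta * F.sigma x ∈ (F.Kr : Set D.GLr) * {F.sigma F.a} * (F.Kr : Set D.GLr)}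

/-- The quotient set `I(ℚ)\(Y^p × Y_p)`, as the set of `I(ℚ)`-orbits (for `I(ℚ)` acting diagonally by left
translation through `iotaP`, `iotaL`) of the points of `Y^p × Y_p`. [cite: Kottwitz1992, §16 (p. 432)] -/
def orbits : Set (Set ((D.GAfp ⧸ F.Kpg) × (D.GLr ⧸ F.Kr))) :=
  {O | ∃ q ∈ F.Yp ×ˢ F.YL, O = {q' | ∃ i : IQ, q' = (F.iotaP i • q.1, F.iotaL i • q.2)}}

/-- The fixed points `(A, λ, i, η̄)` for which `(𝐀, λ, i)` is isogenous to `(𝐀₀, λ₀, i₀)`. [cite: Kottwitz1992, §16 (p. 431)] -/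
def FixIsog : Type u := {x : F.Fix // F.IsQIsog (F.objOf x) F.base}

/-! ## §4 The printed statements of §16 as relations over the datum -/

/-- **«Our next goal is to show that `(𝐀, λ, i)` satisfies the three conditions of §14»** (pp. 430–431, proved
there for the object attached to every fixed point), AS A RELATION. [cite: Kottwitz1992, §16 (pp. 430–431)] -/
def Kottwitz1992_16_fixedPoint_assumptions : Prop :=
  ∀ x : F.Fix, D.Assumptions (F.objOf x)

/-- **«We conclude that there is a bijection from the set of fixed points `(A, λ, i, η̄)` with `(𝐀, λ, i)` isogenous
to `(𝐀₀, λ₀, i₀)` to the quotient set `I(ℚ)\(Y^p × Y_p)`»**, AS A RELATION. [cite: Kottwitz1992, §16 (p. 432)] -/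
def Kottwitz1992_16_fixedPoints_bijection : Prop :=
  Nonempty (F.FixIsog ≃ F.orbits)

/-- **«Therefore the integral above is equal to `vol(I(ℚ)\I(𝔸_f)) · O_γ(f̃^p) · TO_δ(φ̃_r)`»** — the number of fixed
points with `(𝐀, λ, i)` isogenous to `(𝐀₀, λ₀, i₀)`, with `f̃^p = 𝟙_{K^p g⁻¹}` against the Haar measure giving
`K^p_g` measure 1 (= `[K^p : K^p_g] • mGamma` on the quotient) and `φ̃_r = 𝟙_{K_r σ(a) K_r}` against the one giving `K_r`
measure 1, AS A RELATION (finiteness of the set is part of the assertion). [cite: Kottwitz1992, §16 (p. 432)] -/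
def Kottwitz1992_16_card_fixedPoints_tilde : Prop :=
  Finite F.FixIsog ∧
    (Nat.card F.FixIsog : ℝ) =
      F.vol * orbitalIntegral F.gamma (((F.Kp : Set D.GAfp) * {F.g⁻¹}).indicator (1 : D.GAfp → ℝ))
                ((F.Kpg.relIndex F.Kp : ℝ≥0∞) • F.mGamma) *
        twistedOrbitalIntegral F.sigma F.delta
          (((F.Kr : Set D.GLr) * {F.sigma F.a} * (F.Kr : Set D.GLr)).indicator (1 : D.GLr → ℝ)) F.mDelta

/-- **«The conclusion is that the number of fixed points `(A, λ, i, η̄)` for which `(𝐀, λ, i)` is isogenous to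
`(𝐀₀, λ₀, i₀)` is equal to `vol(I(ℚ)\I(𝔸_f)) · O_γ(f^p) · TO_δ(φ_r)`, where `f^p` is the characteristic function of
`K^p g⁻¹ K^p`, `φ_r` is the characteristic function of `K_r a K_r`, and where the Haar measure on `G(𝔸_f^p)`
(respectively, `G(L_r)`) used to define the orbital integral (respectively, the twisted orbital integral) is the
one giving measure 1 to `K^p` (respectively, `K_r`)»**, AS A RELATION. [cite: Kottwitz1992, §16 (p. 433)] -/
def Kottwitz1992_16_card_fixedPoints : Prop :=
  Finite F.FixIsog ∧
    (Nat.card F.FixIsog : ℝ) =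
      F.vol * orbitalIntegral F.gamma (((F.Kp : Set D.GAfp) * {F.g⁻¹} * (F.Kp : Set D.GAfp)).indicator (1 : D.GAfp → ℝ)) F.mGamma *
        twistedOrbitalIntegral F.sigma F.delta (((F.Kr : Set D.GLr) * {F.a} * (F.Kr : Set D.GLr)).indicator (1 : D.GLr → ℝ)) F.mDelta

/-- **«the trace of the automorphism `β` induced by our correspondence at a fixed point `x'` is equal to `tr ρ(γ)`,
where `γ ∈ G(𝔸_f^p)` is the element associated to the `c`-polarized virtual `B`-abelian variety `𝐀` obtained from
`x'` (`γ` is well defined up to conjugacy, so that the trace is well defined) … the trace `tr ρ(γ)` is also equal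
to `tr ξ(γ₀)`»** (`γ₀ ∈ G(ℚ)` the element associated to `𝐀`, well defined up to conjugacy in `G(ℚ̄)`), AS A RELATION
— for every choice of the isomorphism and of the `*`-embedding. [cite: Kottwitz1992, §16 (pp. 433–434)] -/
def Kottwitz1992_16_trace_fixedPoint : Prop :=
  (∀ (x : F.Fix) (e₁ : D.Iso1 (F.objOf x)), F.tr x = F.trRho (D.gammaOf (F.objOf x) e₁)) ∧
  (∀ (x : F.Fix) (e₁ : D.Iso1 (F.objOf x)) (T : D.MaxTorus (F.objOf x)) (e : D.Emb (F.objOf x) T),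
      D.IsStarHom e → F.trRho (D.gammaOf (F.objOf x) e₁) = F.trXi (D.gamma0Of (F.objOf x) T e))

end FixedPointData

end Literature.NumberTheory.Kottwitz1992.FixedPointCount
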